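import Summits.CriticalPhenomena.PercolationContinuityZ3.Theorems.PercNearOneGluingNoHeavyPcintKernSymZ6B6Defs
import HarnessLib

/-!
# PCINT lane, kernel check 3/3 of the B3r window certificate `d = 6`, memory 6 (5-step windows, 248832 codes): codes `248000 ≤ c < 248832`

Cell `prim-pcint`, seat `prim-pcint-2` (gen 2).  Collatz–Wielandt rows `10^5 · row ≤ 99999 · DEN · v` for the window codes in
`[248000, 248832)`, by `decide +kernel` in chunks of `4000` codes (natural-number arithmetic only; `maxHeartbeats 0`).
Does NOT build on p205010.
-/

namespace Summit.CriticalPhenomena.PercolationContinuityZ3.Theorems.Pcint.Z6B6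

set_option maxHeartbeats 0 in
/-- Rows `248000 ≤ c < 248832` of the certificate hold (normal forms only; binary-split scan). [folklore] -/
theorem chk_248000_248832 : WinK.allRange (WinK.nfOKB 6 4 927 10044 9957 99999 tbl 79726) 248000 248832 = true :=
  WinK.allRange_of_allRangeB (fuel := 20) (lo := 248000) (len := 832) (by decide +kernel)

/-- Rows `248000 ≤ c < 248832` of the certificate hold. [folklore] -/
theorem chkFile_3 : WinK.allRange (WinK.nfOKB 6 4 927 10044 9957 99999 tbl 79726) 248000 248832 = true :=
  chk_248000_248832

end Summit.CriticalPhenomena.PercolationContinuityZ3.Theorems.Pcint.Z6B6
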